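import Summits.MatrixMultiplication.MatrixMultiplication.Theorems.SoloBlindLadder

/-!
# Conjecture E reduces to the pair-free stratum (all ranks)

Sub-programme (K₃) (Kraft inequality for zero-sum-free sequences over `𝔽₃`), H-good half.
For `h : ι → G` (exponent-`3` group `G`) zero-sum free on `S` and a target `τ`, the KRAFT MASS is
`E(τ; S) = ∑_{T ⊆ S, ∑_T h = τ} 2^{-|T|}` (`soloBlindMass`).  CONJECTURE E: `E(τ; S) ≤ 1/2` whenever `τ` is
H-good on `S` (`∑_T h ≠ τ + τ` for all `T ⊆ S`).  (Conjecture E implies the Kraft inequality (K₃) on the value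
stratum and is the natural inductive half of it.)

THE PAIR MOVE ON MASSES (`soloBlind_mass_pair_move`): if `{x, y}` represents the H-good target `τ`, then for any
additive `π` with kernel `{0, d, d + d}`, `d = h y - h x`,
`E(τ; S) ≤ 1/4 + E'(π (h x); S \ {x, y}) / 2`, where `E'` is the mass of `π ∘ h` — because every member other
than the pair contains exactly one of `x, y` and `M ↦ M \ {x, y}` is injective into the representations of the
merged target, dropping the size by one.

THE REDUCTION (`soloBlind_conjE_of_pairfree`): if Conjecture E holds for every PAIR-FREE H-good configuration
(all members of size `≥ 3`) in every exponent-`3` group (of a fixed universe), then it holds for all H-good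
configurations.  Proof by strong induction on `|S|`: a member of size `0` is impossible, a member of size `1`
forces `E = 1/2` exactly (`soloBlind_repAll_eq_singleton_of_value`), a member of size `2` is a pair and the pair
move plus induction in the quotient `G ⧸ ℤd` (again exponent `3`, zero-sum free, H-good:
`SoloBlindPairQuotient`) gives `E ≤ 1/4 + 1/4`.
-/

namespace Summit.MatrixMultiplication.MatrixMultiplication.Theorems

open Finset

universe u

variable {ι : Type*} [DecidableEq ι]
variable {G : Type u} [AddCommGroup G] [DecidableEq G]
variable {G' : Type u} [AddCommGroup G'] [DecidableEq G']

/-- All representations of `τ` by `h` on `S` (any size): the `T ⊆ S` with `∑_{i ∈ T} h i = τ`. -/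
def soloBlindSeqRepAll (h : ι → G) (S : Finset ι) (τ : G) : Finset (Finset ι) :=
  S.powerset.filter (fun T => ∑ i ∈ T, h i = τ)

/-- The Kraft mass `E(τ; S) = ∑_{T represents τ} 2^{-|T|}`. -/
def soloBlindMass (h : ι → G) (S : Finset ι) (τ : G) : ℚ :=
  ∑ T ∈ soloBlindSeqRepAll h S τ, (1 / 2 : ℚ) ^ T.card

omit [DecidableEq ι] in
/-- Membership in `soloBlindSeqRepAll`. -/
theorem soloBlind_mem_seqRepAll {h : ι → G} {S : Finset ι} {τ : G} {T : Finset ι} :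
    T ∈ soloBlindSeqRepAll h S τ ↔ T ⊆ S ∧ ∑ i ∈ T, h i = τ := by
  simp [soloBlindSeqRepAll]

omit [DecidableEq ι] in
/-- A representation of any size is a representation of its own size. -/
theorem soloBlind_seqRep_of_repAll {h : ι → G} {S : Finset ι} {τ : G} {T : Finset ι}
    (hT : T ∈ soloBlindSeqRepAll h S τ) : T ∈ soloBlindSeqRep h S T.card τ := by
  obtain ⟨hTS, hsum⟩ := soloBlind_mem_seqRepAll.mp hT
  exact soloBlind_mem_seqRep.mpr ⟨hTS, rfl, hsum⟩

omit [DecidableEq ι] in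
/-- An H-good target has no empty representation (it is non-zero). -/
theorem soloBlind_repAll_card_ne_zero {h : ι → G} {S : Finset ι} {τ : G}
    (hgood : ∀ T ⊆ S, ∑ i ∈ T, h i ≠ τ + τ) {T : Finset ι} (hT : T ∈ soloBlindSeqRepAll h S τ) :
    T.card ≠ 0 := by
  intro h0
  obtain ⟨-, hsum⟩ := soloBlind_mem_seqRepAll.mp hT
  rw [Finset.card_eq_zero] at h0
  rw [h0, Finset.sum_empty] at hsum
  exact hgood ∅ (Finset.empty_subset _) (by rw [Finset.sum_empty, ← hsum, add_zero])

/-- VALUE STRATUM: if `h p = τ` for some `p ∈ S` (and `τ` is H-good), then `{p}` is the ONLY representation of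
`τ`; in particular `E(τ; S) = 1/2` exactly. -/
theorem soloBlind_repAll_eq_singleton_of_value {h : ι → G} {S : Finset ι}
    (zsf : ∀ T ⊆ S, T.Nonempty → ∑ i ∈ T, h i ≠ 0) {τ : G}
    (hgood : ∀ T ⊆ S, ∑ i ∈ T, h i ≠ τ + τ) {p : ι} (hp : p ∈ S) (hpτ : h p = τ) :
    soloBlindSeqRepAll h S τ = {{p}} := by
  ext M
  rw [Finset.mem_singleton]
  constructor
  · intro hM
    obtain ⟨hMS, hsum⟩ := soloBlind_mem_seqRepAll.mp hM
    have hc0 := soloBlind_repAll_card_ne_zero hgood hM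
    by_cases hc1 : M.card = 1
    · obtain ⟨p', rfl⟩ := Finset.card_eq_one.mp hc1
      rw [Finset.sum_singleton] at hsum
      by_contra hne
      have hne' : p' ≠ p := fun e => hne (by rw [e])
      refine hgood {p', p} (Finset.insert_subset (hMS (Finset.mem_singleton_self _))
        (Finset.singleton_subset_iff.mpr hp)) ?_
      rw [Finset.sum_pair hne', hsum, hpτ]
    · exact (soloBlind_hgood_value_tau_kills zsf hgood hp hpτ (k := M.card) (by omega)
        (soloBlind_seqRep_of_repAll hM)).elim
  · intro e
    rw [e, soloBlind_mem_seqRepAll]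
    exact ⟨Finset.singleton_subset_iff.mpr hp, by rw [Finset.sum_singleton, hpτ]⟩

/-- The mass on the value stratum is exactly `1/2`. -/
theorem soloBlind_mass_of_value {h : ι → G} {S : Finset ι}
    (zsf : ∀ T ⊆ S, T.Nonempty → ∑ i ∈ T, h i ≠ 0) {τ : G}
    (hgood : ∀ T ⊆ S, ∑ i ∈ T, h i ≠ τ + τ) {p : ι} (hp : p ∈ S) (hpτ : h p = τ) :
    soloBlindMass h S τ = 1 / 2 := by
  rw [soloBlindMass, soloBlind_repAll_eq_singleton_of_value zsf hgood hp hpτ, Finset.sum_singleton,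
    Finset.card_singleton, pow_one]

/-- Removing the pair from a member through `z` (and avoiding `z'`), `{z, z'} = {x, y}`: the remainder
`M \ {x, y}` has one element less and sum `τ - h z = h z'`. -/
theorem soloBlind_trace_through {h : ι → G} {S : Finset ι} {τ : G} {x y z z' : ι} {M : Finset ι}
    (hzz' : ({z, z'} : Finset ι) = {x, y}) (hs : h z + h z' = τ) (hM : M ∈ soloBlindSeqRepAll h S τ)
    (hzM : z ∈ M) (hz'M : z' ∉ M) :
    M = insert z (M \ {x, y}) ∧ (M \ {x, y}).card + 1 = M.card ∧ ∑ i ∈ M \ {x, y}, h i = h z' := by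
  obtain ⟨-, hMsum⟩ := soloBlind_mem_seqRepAll.mp hM
  have hEq : M \ {x, y} = M.erase z := by
    ext w
    rw [← hzz']
    simp only [Finset.mem_sdiff, Finset.mem_insert, Finset.mem_singleton, Finset.mem_erase]
    constructor
    · rintro ⟨hw, hn⟩
      exact ⟨fun e => hn (Or.inl e), hw⟩
    · rintro ⟨hne, hw⟩
      refine ⟨hw, fun e => ?_⟩
      rcases e with e | e
      · exact hne e
      · exact hz'M (e ▸ hw)
  rw [hEq]
  refine ⟨(Finset.insert_erase hzM).symm, Finset.card_erase_add_one hzM, ?_⟩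
  have e := Finset.add_sum_erase M h hzM
  rw [hMsum, ← hs] at e
  exact add_left_cancel e

/-- Under H-goodness, every representation other than the pair `{x, y}` itself contains exactly one of `x, y`. -/
theorem soloBlind_repAll_one_of {h : ι → G} {S : Finset ι}
    (zsf : ∀ T ⊆ S, T.Nonempty → ∑ i ∈ T, h i ≠ 0) {τ : G}
    (hgood : ∀ T ⊆ S, ∑ i ∈ T, h i ≠ τ + τ) {x y : ι}
    (hP : ({x, y} : Finset ι) ∈ soloBlindSeqRep h S 2 τ) {M : Finset ι} (hM : M ∈ soloBlindSeqRepAll h S τ)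
    (hMP : M ≠ {x, y}) : (x ∈ M ∧ y ∉ M) ∨ (y ∈ M ∧ x ∉ M) := by
  obtain ⟨hPS, hPc, hPsum⟩ := soloBlind_mem_seqRep.mp hP
  have hM' := soloBlind_seqRep_of_repAll hM
  have hc0 := soloBlind_repAll_card_ne_zero hgood hM
  -- not both
  have hnb : ¬ (x ∈ M ∧ y ∈ M) := by
    rintro ⟨hxM, hyM⟩
    have hsub : ({x, y} : Finset ι) ⊆ M :=
      Finset.insert_subset hxM (Finset.singleton_subset_iff.mpr hyM)
    by_cases hc2 : M.card ≤ 2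
    · exact hMP (Finset.eq_of_subset_of_card_le hsub (by rw [hPc]; exact hc2)).symm
    · obtain ⟨k, hk⟩ : ∃ k, M.card = k + 1 := ⟨M.card - 1, by omega⟩
      rw [hk] at hM'
      exact soloBlind_pair_not_both zsf hP (k := k) (by omega) hM' hxM hyM
  -- not disjoint
  have hnd : ¬ (x ∉ M ∧ y ∉ M) := by
    rintro ⟨hxM, hyM⟩
    refine soloBlind_hgood_not_disjoint hgood hM' hP (Finset.disjoint_right.mpr ?_)
    intro w hw
    simp only [Finset.mem_insert, Finset.mem_singleton] at hw
    rcases hw with hw | hw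
    · rw [hw]; exact hxM
    · rw [hw]; exact hyM
  by_cases hxM : x ∈ M
  · exact Or.inl ⟨hxM, fun hyM => hnb ⟨hxM, hyM⟩⟩
  · right
    refine ⟨?_, hxM⟩
    by_contra hyM
    exact hnd ⟨hxM, hyM⟩

omit [DecidableEq G'] in
/-- THE PAIR MOVE ON MASSES: for an H-good `τ` with pair representation `{x, y}` and an additive `π` identifying
`h x` and `h y` (kernel `{0, d, d + d}` not even needed here), `E(τ; S) ≤ 1/4 + E'(π (h x); S \ {x, y}) / 2`,
`E'` the mass of `π ∘ h`. -/
theorem soloBlind_mass_pair_move [DecidableEq G'] (three : ∀ g : G, g + g + g = 0) {h : ι → G}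
    {S : Finset ι} (zsf : ∀ T ⊆ S, T.Nonempty → ∑ i ∈ T, h i ≠ 0) {τ : G}
    (hgood : ∀ T ⊆ S, ∑ i ∈ T, h i ≠ τ + τ) {x y : ι}
    (hP : ({x, y} : Finset ι) ∈ soloBlindSeqRep h S 2 τ) (π : G →+ G') (hπ : π (h x) = π (h y)) :
    soloBlindMass h S τ ≤
      1 / 4 + (1 / 2) * soloBlindMass (fun i => π (h i)) (S \ {x, y}) (π (h x)) := by
  obtain ⟨hPS, hPc, hPsum⟩ := soloBlind_mem_seqRep.mp hP
  have hxy : x ≠ y := by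
    intro e; rw [e] at hPc; simp at hPc
  rw [Finset.sum_pair hxy] at hPsum
  have hne : h x ≠ h y := soloBlind_hgood_pair_values_ne three hgood hP
  have hPall : ({x, y} : Finset ι) ∈ soloBlindSeqRepAll h S τ :=
    soloBlind_mem_seqRepAll.mpr ⟨hPS, by rw [Finset.sum_pair hxy]; exact hPsum⟩
  set F := soloBlindSeqRepAll h S τ with hF
  set F' := soloBlindSeqRepAll (fun i => π (h i)) (S \ {x, y}) (π (h x)) with hF'
  set f : Finset ι → Finset ι := fun M => M \ {x, y} with hf
  -- trace data for members other than the pair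
  have trace : ∀ M ∈ F.erase {x, y},
      f M ∈ F' ∧ (f M).card + 1 = M.card ∧
        ((M = insert x (f M) ∧ ∑ i ∈ f M, h i = h y) ∨ (M = insert y (f M) ∧ ∑ i ∈ f M, h i = h x)) := by
    intro M hM
    obtain ⟨hMP, hMF⟩ := Finset.mem_erase.mp hM
    obtain ⟨hMS, -⟩ := soloBlind_mem_seqRepAll.mp hMF
    have hsub : f M ⊆ S \ {x, y} := Finset.sdiff_subset_sdiff hMS (subset_refl _)
    rcases soloBlind_repAll_one_of zsf hgood hP hMF hMP with ⟨hxM, hyM⟩ | ⟨hyM, hxM⟩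
    · obtain ⟨e1, e2, e3⟩ := soloBlind_trace_through rfl hPsum hMF hxM hyM
      refine ⟨soloBlind_mem_seqRepAll.mpr ⟨hsub, ?_⟩, e2, Or.inl ⟨e1, e3⟩⟩
      rw [← map_sum, e3, hπ]
    · obtain ⟨e1, e2, e3⟩ :=
        soloBlind_trace_through (Finset.pair_comm y x) (by rw [add_comm]; exact hPsum) hMF hyM hxM
      refine ⟨soloBlind_mem_seqRepAll.mpr ⟨hsub, ?_⟩, e2, Or.inr ⟨e1, e3⟩⟩
      rw [← map_sum, e3]
  have hinj : Set.InjOn f ↑(F.erase {x, y}) := by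
    intro M hM M' hM' e
    rw [Finset.mem_coe] at hM hM'
    obtain ⟨-, -, hc⟩ := trace M hM
    obtain ⟨-, -, hc'⟩ := trace M' hM'
    rcases hc with ⟨e1, s1⟩ | ⟨e1, s1⟩ <;> rcases hc' with ⟨e1', s1'⟩ | ⟨e1', s1'⟩
    · rw [e1, e1', e]
    · exact absurd (s1.symm.trans (by rw [e]; exact s1')).symm hne
    · exact absurd (s1'.symm.trans (by rw [← e]; exact s1)).symm hne
    · rw [e1, e1', e]
  -- split off the pair
  have hsplit : soloBlindMass h S τ =
      (1 / 2 : ℚ) ^ 2 + ∑ M ∈ F.erase {x, y}, (1 / 2 : ℚ) ^ M.card := by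
    rw [soloBlindMass, ← hF, ← Finset.add_sum_erase F _ hPall, hPc]
  -- rewrite the remaining sum through f
  have hrest : ∑ M ∈ F.erase {x, y}, (1 / 2 : ℚ) ^ M.card =
      (1 / 2) * ∑ U ∈ (F.erase {x, y}).image f, (1 / 2 : ℚ) ^ U.card := by
    rw [Finset.sum_image hinj, Finset.mul_sum]
    refine Finset.sum_congr rfl ?_
    intro M hM
    obtain ⟨-, hc, -⟩ := trace M hM
    rw [← hc, pow_succ, mul_comm]
  have himg : (F.erase {x, y}).image f ⊆ F' := by
    intro U hU
    obtain ⟨M, hM, rfl⟩ := Finset.mem_image.mp hU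
    exact (trace M hM).1
  have hle : ∑ U ∈ (F.erase {x, y}).image f, (1 / 2 : ℚ) ^ U.card ≤
      ∑ U ∈ F', (1 / 2 : ℚ) ^ U.card :=
    Finset.sum_le_sum_of_subset_of_nonneg himg (fun U _ _ => by positivity)
  rw [hsplit, hrest, soloBlindMass, ← hF']
  have hq : (1 / 2 : ℚ) ^ 2 = 1 / 4 := by norm_num
  rw [hq]
  have hhalf : (0 : ℚ) ≤ 1 / 2 := by norm_num
  have := mul_le_mul_of_nonneg_left hle hhalf
  linarith

/-- CONJECTURE E REDUCES TO THE PAIR-FREE STRATUM (all ranks): if `E(σ; S') ≤ 1/2` for every exponent-`3` group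
(in the universe of `G`), every `h'` zero-sum free on `S'` and every H-good `σ` all of whose representations have
size `≥ 3`, then `E(τ; S) ≤ 1/2` for every H-good `τ` whatsoever. -/
theorem soloBlind_conjE_of_pairfree
    (hpf : ∀ {G : Type u} [AddCommGroup G] [DecidableEq G], (∀ g : G, g + g + g = 0) →
      ∀ (h : ι → G) (S : Finset ι), (∀ T ⊆ S, T.Nonempty → ∑ i ∈ T, h i ≠ 0) →
      ∀ τ : G, (∀ T ⊆ S, ∑ i ∈ T, h i ≠ τ + τ) →
      (∀ T ∈ soloBlindSeqRepAll h S τ, 3 ≤ T.card) → soloBlindMass h S τ ≤ 1 / 2)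
    (three : ∀ g : G, g + g + g = 0) (h : ι → G) (S : Finset ι)
    (zsf : ∀ T ⊆ S, T.Nonempty → ∑ i ∈ T, h i ≠ 0) (τ : G)
    (hgood : ∀ T ⊆ S, ∑ i ∈ T, h i ≠ τ + τ) : soloBlindMass h S τ ≤ 1 / 2 := by
  suffices H : ∀ n : ℕ, ∀ {G : Type u} [AddCommGroup G] [DecidableEq G], (∀ g : G, g + g + g = 0) →
      ∀ (h : ι → G) (S : Finset ι), S.card ≤ n → (∀ T ⊆ S, T.Nonempty → ∑ i ∈ T, h i ≠ 0) →
      ∀ τ : G, (∀ T ⊆ S, ∑ i ∈ T, h i ≠ τ + τ) → soloBlindMass h S τ ≤ 1 / 2 from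
    H S.card three h S le_rfl zsf τ hgood
  intro n
  induction n using Nat.strong_induction_on with
  | _ n ih =>
    intro G _ _ three h S hSn zsf τ hgood
    classical
    by_cases hsmall : ∃ T ∈ soloBlindSeqRepAll h S τ, T.card ≤ 2
    · obtain ⟨T, hT, hTc⟩ := hsmall
      have hc0 := soloBlind_repAll_card_ne_zero hgood hT
      obtain ⟨hTS, hTsum⟩ := soloBlind_mem_seqRepAll.mp hT
      by_cases hc1 : T.card = 1
      · obtain ⟨p, rfl⟩ := Finset.card_eq_one.mp hc1
        rw [Finset.sum_singleton] at hTsum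
        rw [soloBlind_mass_of_value zsf hgood (hTS (Finset.mem_singleton_self p)) hTsum]
      · have hc2 : T.card = 2 := by omega
        obtain ⟨x, y, hxy, rfl⟩ := Finset.card_eq_two.mp hc2
        have hP : ({x, y} : Finset ι) ∈ soloBlindSeqRep h S 2 τ :=
          soloBlind_mem_seqRep.mpr ⟨hTS, hc2, hTsum⟩
        have hker := soloBlind_quot_ker three (h y - h x)
        have hπ := soloBlind_quot_pair (h x) (h y)
        have three' := soloBlind_quot_three three (AddSubgroup.zmultiples (h y - h x))
        have zsf' := soloBlind_move_zsf three zsf hgood hP _ hker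
        have hgood' := soloBlind_move_hgood three zsf hgood hP _ hker
        have hmove := soloBlind_mass_pair_move three zsf hgood hP _ hπ
        have hcard : (S \ {x, y}).card < n := by
          have := Finset.card_sdiff_add_card_eq_card hTS
          rw [hc2] at this
          omega
        have ih' := ih _ hcard three' _ (S \ {x, y}) le_rfl zsf' _ hgood'
        linarith
    · push Not at hsmall
      exact hpf three h S zsf τ hgood (fun T hT => by have := hsmall T hT; omega)

end Summit.MatrixMultiplication.MatrixMultiplication.Theorems
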